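import Summits.Ventures.PercRepro.HJoin

/-!
# The H-join is a lattice join of per-part profiles (generic)

For each part `i` and avoid set `X`, its H-connectivity avoiding `X` restricted to the terminals
outside `X` is an equivalence relation `hProfile i` — the per-part **profile** of the 4-terminal
profile theorem.  `hchain_iff_iSup_hProfile`: the chain of H-join steps of `HJoin` between two such
terminals is exactly the supremum `⨆ i, hProfile i` in the complete lattice of equivalence relations
on those terminals (Mathlib's `Setoid` lattice: the equivalence closure of the union, which for a
symmetric union is its reflexive–transitive closure).  Hence `HBad` / `HO1` / `HO2` of a gluing are
evaluations of the JOIN of the parts' profiles (`hBad_iff_iSup_hProfile`, `hO1_iff_iSup_hProfile`)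
— the shape that `JoinCount` turns into a Möbius-inverted sum of products of per-part counts.
-/

namespace PercRepro

namespace MultiGraph

section HProfileJoin

variable {V E ι : Type*} {G : MultiGraph V E}

/-! ### The H-join as a lattice join of per-part profiles -/

/-- The terminals outside the avoid set. -/
abbrev TermOut (Cen X : Set V) : Type _ := {t : V // t ∈ Cen ∧ t ∉ X}

variable (G)

/-- **The H-profile of a part**: its H-connectivity avoiding `X`, as an equivalence relation on the
terminals outside `X` (the datum of the 4-terminal profile theorem, one per part and avoid set). -/
def hProfile (S : Config E) (c : V) (pe : E → ι) (i : ι) (Cen X : Set V) : Setoid (TermOut Cen X) where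
  r t t' := G.HConnAvoidIn S c pe i X t.1 t'.1
  iseqv := ⟨fun _ => Relation.ReflTransGen.refl, fun h => h.symm, fun h h' => h.trans h'⟩

variable {G}

/-- The union of the profiles is a symmetric relation. -/
instance hProfile_union_symm (S : Config E) (c : V) (pe : E → ι) (Cen X : Set V) :
    Std.Symm (fun t t' : TermOut Cen X => ∃ i, G.hProfile S c pe i Cen X t t') where
  symm _ _ h := h.elim fun i hi => ⟨i, HConnAvoidIn.symm hi⟩

/-- **The H-chain is the join of the profiles.** Between terminals outside `X`, a chain of H-join
steps is exactly the relation of the supremum `⨆ i, hProfile i` in the lattice of equivalence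
relations on the terminals outside `X`. -/
theorem hchain_iff_iSup_hProfile (S : Config E) (c : V) (pe : E → ι) (Cen X : Set V)
    (u v : TermOut Cen X) :
    Relation.ReflTransGen (G.HJoinStep S c pe Cen X) u.1 v.1 ↔
      (⨆ i, G.hProfile S c pe i Cen X) u v := by
  -- the supremum is the equivalence closure of the union, which is its reflexive–transitive closure
  have hsup : (⨆ i, G.hProfile S c pe i Cen X) u v ↔
      Relation.ReflTransGen (fun t t' : TermOut Cen X => ∃ i, G.hProfile S c pe i Cen X t t') u v := by
    rw [iSup, Setoid.sSup_eq_eqvGen, ← Relation.EqvGen.eqvGen_eq_reflTransGen]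
    show Relation.EqvGen _ u v ↔ Relation.EqvGen _ u v
    constructor
    · intro h
      have hle : (fun x y : TermOut Cen X =>
          ∃ r ∈ Set.range (fun i => G.hProfile S c pe i Cen X), r x y) ≤
          (fun t t' : TermOut Cen X => ∃ i, G.hProfile S c pe i Cen X t t') := by
        rintro x y ⟨r, ⟨i, rfl⟩, hr⟩
        exact ⟨i, hr⟩
      exact Relation.EqvGen.mono hle u v h
    · intro h
      have hle : (fun t t' : TermOut Cen X => ∃ i, G.hProfile S c pe i Cen X t t') ≤
          (fun x y : TermOut Cen X =>
            ∃ r ∈ Set.range (fun i => G.hProfile S c pe i Cen X), r x y) := by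
        rintro x y ⟨i, hi⟩
        exact ⟨_, ⟨i, rfl⟩, hi⟩
      exact Relation.EqvGen.mono hle u v h
  rw [hsup]
  clear hsup
  constructor
  · intro h
    -- lift the chain on `V` to the subtype: every vertex of it is a terminal outside `X`
    have key : ∀ {w : V}, Relation.ReflTransGen (G.HJoinStep S c pe Cen X) u.1 w →
        ∃ hw : w ∈ Cen ∧ w ∉ X, Relation.ReflTransGen
          (fun t t' : TermOut Cen X => ∃ i, G.hProfile S c pe i Cen X t t') u ⟨w, hw⟩ := by
      intro w hw
      induction hw with
      | refl => exact ⟨u.2, Relation.ReflTransGen.refl⟩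
      | @tail w w' _ hstep ih =>
        obtain ⟨hw, hR⟩ := ih
        obtain ⟨_, hw'C, _, hw'X, i, hi⟩ := hstep
        exact ⟨⟨hw'C, hw'X⟩, hR.tail ⟨i, hi⟩⟩
    obtain ⟨hv, hR⟩ := key h
    convert hR
  · intro h
    induction h with
    | refl => exact Relation.ReflTransGen.refl
    | @tail t t' _ hstep ih =>
      obtain ⟨i, hi⟩ := hstep
      exact ih.tail ⟨t.2.1, t'.2.1, t.2.2, t'.2.2, i, hi⟩

/-- **`BAD` of a gluing is the join of the parts' H-profiles** (avoid set `∅`). -/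
theorem hBad_iff_iSup_hProfile (S : Config E) (pe : E → ι) (br : V → ι) (Cen : Set V)
    (hpart : ∀ e, (G.fst e ∉ Cen → pe e = br (G.fst e)) ∧ (G.snd e ∉ Cen → pe e = br (G.snd e)))
    {a b c : V} (ha : a ∈ Cen) (hb : b ∈ Cen) :
    G.HBad S a b c ↔ (⨆ i, G.hProfile S c pe i Cen ∅) ⟨a, ha, Set.notMem_empty a⟩
      ⟨b, hb, Set.notMem_empty b⟩ := by
  rw [G.hBad_iff_hchain S pe br Cen hpart ha hb]
  exact G.hchain_iff_iSup_hProfile S c pe Cen ∅ ⟨a, ha, Set.notMem_empty a⟩ ⟨b, hb, Set.notMem_empty b⟩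

/-- **`o1` of a gluing is the join of the parts' H-profiles** avoiding the cluster of `b` (for `a`
and `c` outside that cluster — automatic in a bot configuration). -/
theorem hO1_iff_iSup_hProfile (S : Config E) (pe : E → ι) (br : V → ι) (Cen : Set V)
    (hpart : ∀ e, (G.fst e ∉ Cen → pe e = br (G.fst e)) ∧ (G.snd e ∉ Cen → pe e = br (G.snd e)))
    {a b c : V} (ha : a ∈ Cen) (hc : c ∈ Cen) (haX : a ∉ G.cluster S b) (hcX : c ∉ G.cluster S b) :
    G.HO1 S a b c ↔ (⨆ i, G.hProfile S c pe i Cen (G.cluster S b)) ⟨c, hc, hcX⟩ ⟨a, ha, haX⟩ := by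
  rw [G.hO1_iff_hchain S pe br Cen hpart ha hc]
  exact G.hchain_iff_iSup_hProfile S c pe Cen (G.cluster S b) ⟨c, hc, hcX⟩ ⟨a, ha, haX⟩

end HProfileJoin

end MultiGraph

end PercRepro
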